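import Summits.QuantumFields.YangMills.Theorems.BalabanUVNodesN26AtBetaOfRecord11B13Layers
import Literature.MathematicalPhysics.QuantumFieldTheory.Balaban1983to89.Beta.HistoryContinuity

/-!
# DAG node N26 — binder B4's ONE clause (C-pt) on the (D4) object REDUCED TO LEAFWISE HISTORY-CONTINUITY (C-leaf), by one Weierstrass M-test over the
# leaves with the chain's OWN history-free majorant; B4 ∕ the rows-(D4) ∧ B4 residue ∕ K2′'s stub at θ from (C-leaf)

Cell `pub-ymgap`, YM-PLAN Track A (HUMAN RULING D-0062), seat `pub-ymgap-dag-n26-c` gen 3 (R134 acceleration seat, s2).  Fifth N26 module of the seat, over the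
row-(D4) owner's `BalabanUVNodesN26AtBetaOfRecord11B13Layers` (b2b-balaban-beta-an4 g124, p468083); sibling of the seat's `BalabanUVNodesN26AtRecord12B13RunLayers` (p470063).  STATUS OF RECORD: N26 = binder B4 is DEPENDENT on (D4) and VACATED in the discharge form of record (closes WITH
B3 = N25, NODE O); the (D4)-chain instance for Bałaban's objects is 0∕1.

THE POINT.  `Gaps.BetaContFromD4Chain` §1 records that binder B4 (`FlowStep.BetaContH γ β`, joint continuity of `β_{k+1}` in the history on `]0,γ]^{k+1}`) costs, on
ONE row-(D4) chain `R : ChainTFac190H d M μ ν S γ c ℓ α₂ q` with its side conditions N1–N3, exactly ONE further clause of printed TYPE: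
  (C-pt) `CPt R : ∀ k x, ContinuousOn (p ↦ limKernel (R.A1 k p) x) (Box γ k)`
— continuity in the history of the infinite-volume remainder KERNEL at each site, `limKernel (R.A1 k p) x = Σ'_Y A¹_{k+1}(p; Y, x)` being an INFINITE sum over the
localization domains Y ∈ 𝐃(ℤ^d) ([I] (1.21) via (1.7)); `Beta.BetaContinuity`'s header files (C-pt) as «a located input (cell GAPS G-an4-1 (iv))».  This module shows,
with NO new datum and NO volume-side structure (contrast `Beta.LocalizedVolumeRate.cpt_of_localizedFamily`, which routes (C) through a separate `LocalizedFamily` of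
finite-volume terms with stabilisation), that ON THE SAME OBJECT the clause reduces further to
  (C-leaf) `∀ k Y x, ContinuousOn (p ↦ R.A1 k p Y x) (Box γ k)`
— continuity in the history of EACH ℤ^d LEAF KERNEL separately, i.e. of finitely generated data per term: the chain's own leaves dominate `|R.A1 k p Y x|` by the
HISTORY-FREE summable majorant `Beta.RemainderLimitTorus.major d M c α₂ q.B₃ Y` (`PolLeavesTLocH.tendsto_sum`, the (5.1) limit theorem of the holomorphic currency), so
the Weierstrass M-test over Y (`continuousOn_tsum`) sums (C-leaf) to (C-pt).  (C-leaf) is print's sentence after (1.22), [I] p. 264 — *«the coefficients … are analytic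
functions of g_j … with bounded derivatives»* — read PER LOCALIZED TERM, which is how print states it; in the crew's (1.7) read-out letters
(`PolLeavesTFac190H.ha : a Y z = Re ∂²(F Y)(t Y 0, t Y z)`) it is continuity in the history of `Re ∂²(Fw k p Y)(t k p Y 0, t k p Y x)` (`leafwise_of_readout`).
* §1 (generic d): `abs_A1_le_major`, `summable_A1`, `cpt_of_leafwise`, `betaContH_of_chainTFac190H_leafwise` (B4 ⇐ chain + N1–N3 + (C-leaf), any `d ≥ 1`),
  `atSlopeCont_of_chainTFac190H_leafwise` (d = 4), `leafwise_of_readout`; and ONE STEP FURTHER, `leafwise_of_values` ∕ `betaContH_of_chainTFac190H_of_values`: (C-leaf) —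
  hence B4 — from p. 263's PRINTED-TYPE clauses on the VALUES of history-parametrised (1.7) functionals on history-free test spaces (analytic on a fixed ball, (1.18)-type
  bound uniform in the history, values continuous in the history), by the row's Cauchy transfer `Beta.HistoryContinuity.continuousOn_mixedDeriv` applied PER LEAF —
  so that on the (D4) object nothing about kernels, sums, limits or volumes remains of binder B4.
* §2 at NODE 00's β of record, exposed-kernel currency (p457986 §2 ∕ an4's `chainTFac190H_ofB13Layers` ∕ p470063 §1 all produce `∃ R, R.A1 = A1`):
  `betaContH_betaOfRecord₁₁_of_exists_chainTFac190H_leafwise`, `atSlopeCont_oneLoopSplitOfRecord₁₁_of_exists_chainTFac190H_leafwise` — every landed instance at the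
  record now concludes B4 ∕ the residue from (C-leaf) on its exposed kernels.
* §3 `d4AtSlopeOfD1Record12_at_of_runLayers_leafwise` — crux K2′'s registered stub `D4AtSlopeOfD1Record12` AT θ from the record's run-indexed [B13] layers
  (an4's `chainTFac190H_ofB13Layers` along run sequences, as in p470063) with (C-pt) REPLACED by continuity in the history of the (1.7) read-outs.

HONEST FRAMING.  [folklore] real analysis (dominated summation) over the tree's typed (D4) objects; 0 `def`, 0 `sorry`; NO located estimate of Bałaban's is removed or
asserted — (C-leaf) stays a displayed hypothesis of printed TYPE (NODE O's, per term instead of per site-kernel); (D4) INSTANCE 0∕1, D4 DISCHARGE NO DATE;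
`stub_d4AtSlopeCont12` NOT proved; N25 ∕ N26 NOT discharged; counts unmoved.  One finite four-torus programme at fixed ε per run — NOT the continuum limit, NOT ℝ⁴, NOT
infinite volume, NOT OS, NOT a mass gap, NOT Clay.
Sources (context): [I] = [Balaban1987RG1] CMP **109** (1987): (1.7) p. 261, (1.20)–(1.22) p. 264, (5.1) p. 292, (5.10) p. 293; [II] = [Balaban1988RG2Cluster] CMP **116**
(1988): Lemma 3 (2.38) p. 20, p. 21; [15] = [Balaban1985Variational] CMP **102** (1985): (190) p. 308.
-/

noncomputable section

open scoped Matrix.Norms.L2Operator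

namespace Summit.QuantumFields.YangMills.Theorems.BalabanUVNodesN26CPtLeafwise

open Literature.MathematicalPhysics.QuantumFieldTheory.Balaban1983to89
open Literature.MathematicalPhysics.QuantumFieldTheory.Balaban1983to89.FlowStep
open Literature.MathematicalPhysics.QuantumFieldTheory.Balaban1983to89.FlowStepRuns (histBox_of_mem_box)
open Literature.MathematicalPhysics.QuantumFieldTheory.Balaban1983to89.T4Continuum (T4Family)
open Literature.MathematicalPhysics.QuantumFieldTheory.Balaban1983to89.Node00
open Literature.MathematicalPhysics.QuantumFieldTheory.Balaban1983to89.B13ScaleTransfer (Pt)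
open Literature.MathematicalPhysics.QuantumFieldTheory.Balaban1983to89.TreeLengthTorus (TDom proj)
open Literature.MathematicalPhysics.QuantumFieldTheory.Balaban1983to89.B12Decay510 (mixedDeriv)
open Literature.MathematicalPhysics.QuantumFieldTheory.Balaban1983to89.Beta.RemainderChainLattice
open Literature.MathematicalPhysics.QuantumFieldTheory.Balaban1983to89.Beta.RemainderLimitTorus (LDom limKernel tproj major summable_major)
open Literature.MathematicalPhysics.QuantumFieldTheory.Balaban1983to89.Beta.RemainderDecay190 (Consts190 Data190)
open Literature.MathematicalPhysics.QuantumFieldTheory.Balaban1983to89.Beta.RemainderDecay190HoloChain (ChainTFac190H)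
open Literature.MathematicalPhysics.QuantumFieldTheory.Balaban1983to89.Beta.RemainderWOfRecordB13
open Literature.MathematicalPhysics.QuantumFieldTheory.Balaban1983to89.Beta.HistoryContinuity (continuousOn_mixedDeriv)
open Summit.QuantumFields.BalabanUV.Gaps
open Summit.QuantumFields.BalabanUV.Gaps.BetaContFromD4Chain
open Summit.QuantumFields.YangMills.Theorems.BalabanUVNodesN26AtBetaOfRecord11StepObjects
  (betaContH_betaOfRecord₁₁_of_exists_chainTFac190H atSlopeCont_oneLoopSplitOfRecord₁₁_of_exists_chainTFac190H)
open Summit.QuantumFields.YangMills.Theorems.BalabanUVNodesN26AtBetaOfRecord11B13Layers (chainTFac190H_ofB13Layers)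
open Metric Filter Topology

/-! ## §1 (C-leaf) ⟹ (C-pt) on one (D4) chain, any dimension: the M-test over the leaves with the chain's own history-free majorant -/

section Generic

variable {d M : ℕ} [NeZero M] {μ ν : Fin d} {β : HBeta} {S : B12Beta.OneLoopSplit β} {γ : ℝ} {c : B13.Consts} {ℓ α₂ : ℝ}
  {q : Consts190}

/-- **THE CHAIN's OWN HISTORY-FREE MAJORANT OF ITS ℤ^d LEAF KERNELS**: for a row-(D4) chain with N1–N3 and a history `p ∈ ]0,γ]^{k+1}`, every leaf kernel is dominated
termwise by `major d M c α₂ B₃(q)` — a function of the DOMAIN ONLY (`(R.leaves k p _).toPolLeavesTFacH.toPolLeavesTLocH.tendsto_sum`, the (5.1) limit theorem of the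
holomorphic currency: *«the series absolutely convergent and dominated termwise by the summable majorant»*).  The constants do not see the history.
[cite: Balaban1987RG1, (5.1) p.292 and (1.21) p.264; Balaban1988RG2Cluster, Lemma 3 (2.38) p.20] -/
theorem abs_A1_le_major (R : ChainTFac190H d M μ ν S γ c ℓ α₂ q) (hC : CondsL d c ℓ) (h22 : c.R22gen ℓ) (hq : q.Valid c.δ₀)
    (hs : SignsL c α₂ q.B₃) {k : ℕ} {p : Fin (k + 1) → ℝ} (hp : p ∈ Box γ k) (Y : LDom d) (x : Pt d) :
    |R.A1 k p Y x| ≤ major d M c α₂ q.B₃ Y :=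
  ((((R.leaves k p (histBox_of_mem_box hp)).toPolLeavesTFacH hq).toPolLeavesTLocH hs.α₂_pos).tendsto_sum hC h22 hs x).2.1 Y

/-- The leaf sum defining the site kernel `limKernel (R.A1 k p) x = Σ'_Y A1 k p Y x` converges absolutely at every history in the box (same source).
[cite: Balaban1987RG1, (5.1) p.292 and (1.21) p.264] -/
theorem summable_A1 (R : ChainTFac190H d M μ ν S γ c ℓ α₂ q) (hC : CondsL d c ℓ) (h22 : c.R22gen ℓ) (hq : q.Valid c.δ₀)
    (hs : SignsL c α₂ q.B₃) {k : ℕ} {p : Fin (k + 1) → ℝ} (hp : p ∈ Box γ k) (x : Pt d) :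
    Summable fun Y : LDom d => R.A1 k p Y x :=
  ((((R.leaves k p (histBox_of_mem_box hp)).toPolLeavesTFacH hq).toPolLeavesTLocH hs.α₂_pos).tendsto_sum hC h22 hs x).1

/-- **(C-leaf) ⟹ (C-pt)**: on ONE row-(D4) chain with N1–N3, LEAFWISE history-continuity of the ℤ^d leaf kernels — `p ↦ A1 k p Y x` continuous on `]0,γ]^{k+1}` for
every scale `k`, domain `Y` and site `x` — gives binder B4's clause `CPt R` (continuity of the summed site kernel `p ↦ Σ'_Y A1 k p Y x`): Weierstrass M-test over the
domains (`continuousOn_tsum`) with the chain's own history-free summable majorant `major` (`abs_A1_le_major`, `summable_major`).  (C-leaf) is print's sentence after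
(1.22) read per localized term; it stays a displayed hypothesis. [cite: Balaban1987RG1, (1.21)-(1.22) p.264 and (5.1) p.292] -/
theorem cpt_of_leafwise (R : ChainTFac190H d M μ ν S γ c ℓ α₂ q) (hC : CondsL d c ℓ) (h22 : c.R22gen ℓ) (hq : q.Valid c.δ₀)
    (hs : SignsL c α₂ q.B₃) (hleafc : ∀ k (Y : LDom d) (x : Pt d), ContinuousOn (fun p : Fin (k + 1) → ℝ => R.A1 k p Y x) (Box γ k)) :
    CPt R := by
  intro k x
  show ContinuousOn (fun p : Fin (k + 1) → ℝ => ∑' Y : LDom d, R.A1 k p Y x) (Box γ k)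
  refine continuousOn_tsum (f := fun (Y : LDom d) (p : Fin (k + 1) → ℝ) => R.A1 k p Y x) (fun Y => hleafc k Y x)
    (summable_major (d := d) (M := M) (α₂ := α₂) (B₃ := q.B₃) hs.δ₀_pos) fun Y p hp => ?_
  rw [Real.norm_eq_abs]
  exact abs_A1_le_major R hC h22 hq hs hp Y x

/-- **B4 ⇐ ONE (D4) CHAIN + N1–N3 + (C-leaf)** (any `d ≥ 1`; holomorphic currency): `Gaps.BetaContFromD4Chain.betaContH_of_chainTFac190H` with its clause (C-pt) supplied
by `cpt_of_leafwise`.  So binder B4 costs, on the row-(D4) object, exactly LEAFWISE history-continuity of the exposed leaf kernels — nothing at the level of the summed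
kernel. [cite: Balaban1987RG1, (1.21)-(1.22) p.264, (5.1) p.292 and (5.10) p.293; Balaban1988RG2Cluster, Lemma 3 (2.38) p.20] -/
theorem betaContH_of_chainTFac190H_leafwise (R : ChainTFac190H d M μ ν S γ c ℓ α₂ q) (hC : CondsL d c ℓ) (h22 : c.R22gen ℓ)
    (hq : q.Valid c.δ₀) (hs : SignsL c α₂ q.B₃) (hd : 0 < d)
    (hleafc : ∀ k (Y : LDom d) (x : Pt d), ContinuousOn (fun p : Fin (k + 1) → ℝ => R.A1 k p Y x) (Box γ k)) :
    BetaContH γ β :=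
  betaContH_of_chainTFac190H R hC h22 hq hs hd (cpt_of_leafwise R hC h22 hq hs hleafc)

/-- **THE ROWS-(D4) ∧ B4 RESIDUE ⇐ ONE CHAIN + N1–N3 + smallness + (C-leaf)** (d = 4): `Gaps.BetaContFromD4Chain.atSlopeCont_of_chainTFac190H` with (C-pt) from
(C-leaf). [cite: Balaban1988RG2Cluster, Lemma 3 (2.38) p.20 and p.21; Balaban1987RG1, (1.21)-(1.22) p.264 and (5.1) p.292] -/
theorem atSlopeCont_of_chainTFac190H_leafwise {M : ℕ} [NeZero M] {μ ν : Fin 4} {β : HBeta} {S : B12Beta.OneLoopSplit β}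
    {γ : ℝ} {c : B13.Consts} {ℓ α₂ : ℝ} {q : Consts190} (R : ChainTFac190H 4 M μ ν S γ c ℓ α₂ q) (hC : CondsL 4 c ℓ)
    (h22 : c.R22gen ℓ) (hq : q.Valid c.δ₀) (hs : SignsL c α₂ q.B₃) {s : ℝ} (hsmall : c.ε₁ * remCoeffL 4 M c α₂ q.B₃ ≤ s)
    (hleafc : ∀ k (Y : LDom 4) (x : Pt 4), ContinuousOn (fun p : Fin (k + 1) → ℝ => R.A1 k p Y x) (Box γ k)) :
    AtSlopeCont S γ s :=
  atSlopeCont_of_chainTFac190H R hC h22 hq hs hsmall (cpt_of_leafwise R hC h22 hq hs hleafc)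

/-- **(C-leaf) IN THE (1.7) READ-OUT LETTERS**: if the leaf kernels are read off (1.7) functionals along test vectors — `A1 k p Y z = Re ∂²(Fw k p Y)(t k p Y 0, t k p Y z)`
(the crew's `PolLeavesTFac190H.ha` per (k, p)) — then (C-leaf) IS continuity in the history of those read-outs. [cite: Balaban1987RG1, (1.7) p.261, (1.22) p.264 and (4.35) p.290] -/
theorem leafwise_of_readout {d : ℕ} {γ : ℝ} {A1 : (k : ℕ) → (Fin (k + 1) → ℝ) → LDom d → Pt d → ℝ}
    {V : (k : ℕ) → (Fin (k + 1) → ℝ) → LDom d → Type} [∀ k p Y, NormedAddCommGroup (V k p Y)] [∀ k p Y, NormedSpace ℂ (V k p Y)]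
    {Fw : (k : ℕ) → (p : Fin (k + 1) → ℝ) → (Y : LDom d) → V k p Y → ℂ} {t : (k : ℕ) → (p : Fin (k + 1) → ℝ) → (Y : LDom d) → Pt d → V k p Y}
    (ha : ∀ k p (Y : LDom d) (z : Pt d), A1 k p Y z = (mixedDeriv (Fw k p Y) (t k p Y 0) (t k p Y z)).re)
    (hcont : ∀ k (Y : LDom d) (z : Pt d),
      ContinuousOn (fun p : Fin (k + 1) → ℝ => (mixedDeriv (Fw k p Y) (t k p Y 0) (t k p Y z)).re) (Box γ k)) :
    ∀ k (Y : LDom d) (z : Pt d), ContinuousOn (fun p : Fin (k + 1) → ℝ => A1 k p Y z) (Box γ k) :=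
  fun k Y z => (hcont k Y z).congr fun p _ => ha k p Y z

/-- **(C-leaf) FROM PRINTED-TYPE CLAUSES ON THE VALUES OF THE (1.7) FUNCTIONALS — CAUCHY TRANSFER PER LEAF** ([I] p. 263: *«E^{(j)}(X, g_{j−1}, U, J) is defined and
analytic on the space U^c_j(X, α₀, α₁) … It is a C^∞-function of g_{j−1} ∈ [0, γ] … |E^{(j)}(X, g_{j−1}, U, J)| ≦ E₀ exp(−κd_j(X)) (1.18)»*, read per localized term with
the history written out): if the leaf kernels are read off history-parametrised (1.7) functionals `Fw k p Y` on HISTORY-FREE test spaces `V k Y` along history-free test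
vectors `t k Y` — `A1 k p Y z = Re ∂²(Fw k p Y)(t k Y 0, t k Y z)` — and, per (k, Y), every `Fw k p Y` (`p` in the box) is analytic on a fixed ball `‖w‖ < α`, bounded by `S` on
`‖w‖ ≤ ρ < α` UNIFORMLY in the history ((1.18)-type), with the VALUES `p ↦ Fw k p Y w` continuous on the box for each fixed `w` of that closed ball, then (C-leaf) holds:
the row's Cauchy transfer `Beta.HistoryContinuity.continuousOn_mixedDeriv` (continuity of (4.3)∕(1.20) mixed derivatives in a parameter from pointwise continuity of
the values of a uniformly bounded analytic family), applied leaf by leaf.  Nothing about sums, limits or volumes. [cite: Balaban1987RG1, (1.17)-(1.18) p.263, (1.7) p.261 and (4.35) p.290] -/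
theorem leafwise_of_values {d : ℕ} {γ : ℝ} {A1 : (k : ℕ) → (Fin (k + 1) → ℝ) → LDom d → Pt d → ℝ}
    {V : ℕ → LDom d → Type} [∀ k Y, NormedAddCommGroup (V k Y)] [∀ k Y, NormedSpace ℂ (V k Y)]
    {Fw : (k : ℕ) → (Fin (k + 1) → ℝ) → (Y : LDom d) → V k Y → ℂ} {t : (k : ℕ) → (Y : LDom d) → Pt d → V k Y}
    (ha : ∀ k p (Y : LDom d) (z : Pt d), A1 k p Y z = (mixedDeriv (Fw k p Y) (t k Y 0) (t k Y z)).re)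
    (α ρ S : ℕ → LDom d → ℝ) (han : ∀ k (Y : LDom d), ∀ p ∈ Box γ k, AnalyticOnNhd ℂ (Fw k p Y) (ball 0 (α k Y)))
    (hρ : ∀ k Y, 0 < ρ k Y) (hρα : ∀ k Y, ρ k Y < α k Y)
    (hbd : ∀ k (Y : LDom d), ∀ p ∈ Box γ k, ∀ w ∈ closedBall (0 : V k Y) (ρ k Y), ‖Fw k p Y w‖ ≤ S k Y)
    (hval : ∀ k (Y : LDom d), ∀ w ∈ closedBall (0 : V k Y) (ρ k Y), ContinuousOn (fun p : Fin (k + 1) → ℝ => Fw k p Y w) (Box γ k)) :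
    ∀ k (Y : LDom d) (z : Pt d), ContinuousOn (fun p : Fin (k + 1) → ℝ => A1 k p Y z) (Box γ k) := by
  intro k Y z
  have h := continuousOn_mixedDeriv (s := Box γ k) (E := fun p : Fin (k + 1) → ℝ => Fw k p Y) (han k Y) (hρ k Y) (hρα k Y)
    (hbd k Y) (hval k Y) (t k Y 0) (t k Y z)
  exact (Complex.continuous_re.comp_continuousOn h).congr fun p _ => ha k p Y z

/-- **B4 ⇐ ONE (D4) CHAIN + N1–N3 + PRINTED-TYPE VALUE CLAUSES ON ITS (1.7) FUNCTIONALS** (any `d ≥ 1`): if the chain's leaf kernels are read off history-parametrised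
(1.7) functionals on history-free test spaces (`ha`) which are, per (scale, domain), analytic on a fixed ball, (1.18)-type bounded uniformly in the history, and with
history-continuous VALUES, then `BetaContH γ β` — `leafwise_of_values` ∘ `cpt_of_leafwise` ∘ `Gaps.BetaContFromD4Chain.betaContH_of_chainTFac190H`.  So on the
row-(D4) object binder B4 reduces to p. 263's assumptions on the localized terms, written with the history: nothing at the level of kernels, sums or volumes remains.
Every clause a displayed hypothesis; instance 0∕1. [cite: Balaban1987RG1, (1.17)-(1.18) p.263, (1.20)-(1.22) p.264, (5.1) p.292 and (5.10) p.293; Balaban1988RG2Cluster, Lemma 3 (2.38) p.20] -/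
theorem betaContH_of_chainTFac190H_of_values (R : ChainTFac190H d M μ ν S γ c ℓ α₂ q) (hC : CondsL d c ℓ) (h22 : c.R22gen ℓ)
    (hq : q.Valid c.δ₀) (hs : SignsL c α₂ q.B₃) (hd : 0 < d)
    {V : ℕ → LDom d → Type} [∀ k Y, NormedAddCommGroup (V k Y)] [∀ k Y, NormedSpace ℂ (V k Y)]
    {Fw : (k : ℕ) → (Fin (k + 1) → ℝ) → (Y : LDom d) → V k Y → ℂ} {t : (k : ℕ) → (Y : LDom d) → Pt d → V k Y}
    (ha : ∀ k p (Y : LDom d) (z : Pt d), R.A1 k p Y z = (mixedDeriv (Fw k p Y) (t k Y 0) (t k Y z)).re)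
    (α ρ S' : ℕ → LDom d → ℝ) (han : ∀ k (Y : LDom d), ∀ p ∈ Box γ k, AnalyticOnNhd ℂ (Fw k p Y) (ball 0 (α k Y)))
    (hρ : ∀ k Y, 0 < ρ k Y) (hρα : ∀ k Y, ρ k Y < α k Y)
    (hbd : ∀ k (Y : LDom d), ∀ p ∈ Box γ k, ∀ w ∈ closedBall (0 : V k Y) (ρ k Y), ‖Fw k p Y w‖ ≤ S' k Y)
    (hval : ∀ k (Y : LDom d), ∀ w ∈ closedBall (0 : V k Y) (ρ k Y), ContinuousOn (fun p : Fin (k + 1) → ℝ => Fw k p Y w) (Box γ k)) :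
    BetaContH γ β :=
  betaContH_of_chainTFac190H_leafwise R hC h22 hq hs hd (leafwise_of_values ha α ρ S' han hρ hρα hbd hval)

end Generic

/-! ## §2 At NODE 00's β of record, exposed-kernel currency: B4 and the residue from (C-leaf) -/

section Record11

variable (F : T4Family) (N : ℕ) [NeZero N]
variable {γ₀ : ℝ} {M : ℕ} [NeZero M] {μ ν : Fin 4} {c : B13.Consts} {ℓ α₂ : ℝ} {q : Consts190}

/-- **B4 AT `betaOfRecord₁₁ θ` FROM AN EXPOSED-KERNEL INSTANCE + (C-leaf)**: `∃ R, R.A1 = A1` at the record's split (any producer: p457986 §3 step objects, an4's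
`chainTFac190H_ofB13Layers`, p470063's run layers), N1–N3, and LEAFWISE history-continuity of the given leaf kernels `p ↦ A1 k p Y x` ⟹ `BetaContH γ₀ (betaOfRecord₁₁ F N θ)`
(p457986's consumer with (C-pt) from `cpt_of_leafwise`).  θ-keyed, proviso-free; instance 0∕1. [cite: Balaban1987RG1, (1.21)-(1.22) p.264, (5.1) p.292 and (5.10) p.293; Balaban1988RG2Cluster, Lemma 3 (2.38) p.20] -/
theorem betaContH_betaOfRecord₁₁_of_exists_chainTFac190H_leafwise (θ : Stage11Params F N)
    {A1 : (k : ℕ) → (Fin (k + 1) → ℝ) → LDom 4 → Pt 4 → ℝ}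
    (h : ∃ R : ChainTFac190H 4 M μ ν (oneLoopSplitOfRecord₁₁ F N θ) γ₀ c ℓ α₂ q, R.A1 = A1)
    (hC : CondsL 4 c ℓ) (h22 : c.R22gen ℓ) (hq : q.Valid c.δ₀) (hs : SignsL c α₂ q.B₃)
    (hleafc : ∀ k (Y : LDom 4) (x : Pt 4), ContinuousOn (fun p : Fin (k + 1) → ℝ => A1 k p Y x) (Box γ₀ k)) :
    BetaContH γ₀ (betaOfRecord₁₁ F N θ) := by
  obtain ⟨R, hA⟩ := h
  subst hA
  exact betaContH_betaOfRecord₁₁_of_exists_chainTFac190H F N θ ⟨R, rfl⟩ hC h22 hq hs (cpt_of_leafwise R hC h22 hq hs hleafc)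

/-- **THE ROWS-(D4) ∧ B4 RESIDUE AT THE RECORD's SPLIT FROM AN EXPOSED-KERNEL INSTANCE + smallness + (C-leaf)** — what N25's END and the Stage-12 record consumers take.
Instance 0∕1. [cite: Balaban1988RG2Cluster, Lemma 3 (2.38) p.20 and p.21; Balaban1987RG1, (1.21)-(1.22) p.264 and (5.1) p.292] -/
theorem atSlopeCont_oneLoopSplitOfRecord₁₁_of_exists_chainTFac190H_leafwise (θ : Stage11Params F N)
    {A1 : (k : ℕ) → (Fin (k + 1) → ℝ) → LDom 4 → Pt 4 → ℝ}
    (h : ∃ R : ChainTFac190H 4 M μ ν (oneLoopSplitOfRecord₁₁ F N θ) γ₀ c ℓ α₂ q, R.A1 = A1)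
    (hC : CondsL 4 c ℓ) (h22 : c.R22gen ℓ) (hq : q.Valid c.δ₀) (hs : SignsL c α₂ q.B₃) {s : ℝ}
    (hsmall : c.ε₁ * remCoeffL 4 M c α₂ q.B₃ ≤ s)
    (hleafc : ∀ k (Y : LDom 4) (x : Pt 4), ContinuousOn (fun p : Fin (k + 1) → ℝ => A1 k p Y x) (Box γ₀ k)) :
    AtSlopeCont (oneLoopSplitOfRecord₁₁ F N θ) γ₀ s := by
  obtain ⟨R, hA⟩ := h
  subst hA
  exact atSlopeCont_of_chainTFac190H_leafwise R hC h22 hq hs hsmall hleafc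

end Record11

/-! ## §3 K2′'s registered stub at θ from the record's run-indexed [B13] layers with (C-pt) replaced by continuity of the (1.7) read-outs in the history -/

section RunLayers

variable (F : T4Family) (N : ℕ) [NeZero N]
variable {γ₀ : ℝ} {M : ℕ} [NeZero M] {μ ν : Fin 4} {c : B13.Consts} {α₂ : ℝ} {q : Consts190}
variable (θ : Stage12Params F N) (p : B12.RunParams) (lam13 : B12.RunParams → ResidB13 θ.toStage3Params) (hle : γ₀ ≤ θ.γ)
  (A1 : (k : ℕ) → (Fin (k + 1) → ℝ) → LDom 4 → Pt 4 → ℝ)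
  (hm : ∀ k (v : Fin (k + 1) → ℝ), v ∈ Box γ₀ k →
    betaMergedOfRecord₁₁ F N (θ.toStage11 F N p) k v =
      beta0OfRecord₁₁ F N (θ.toStage11 F N p) k + B12Beta.secondMoment (fun _ _ => limKernel (A1 k v)) μ ν)
  (hsp : ∀ P, SpLaw (lam13 P)) (h213 : ∀ P, Law213 (lam13 P))
  (hleaf : ∀ P, B13LeafOfRecord θ.toStage3Params (lam13 P)) (hR : ∀ P, (lam13 P).Restr)
  (hC : CondsL 4 c ((c.L : ℝ) / 2)) (hs : SignsL c α₂ q.B₃)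
  (Ps : (k : ℕ) → (Fin (k + 1) → ℝ) → ℕ → B12.RunParams)
  (hn : ∀ k v, Tendsto (fun m => (lam13 (Ps k v m)).n) atTop atTop)
  (hc : ∀ k v m, c13OfRecord θ.toStage3Params (lam13 (Ps k v m)) = c)
  (Wn : (k : ℕ) → (Fin (k + 1) → ℝ) → ℕ → Type) (instW : ∀ k v m, NormedAddCommGroup (Wn k v m))
  (instWs : ∀ k v m, NormedSpace ℂ (Wn k v m))
  (emb : (k : ℕ) → (v : Fin (k + 1) → ℝ) → (m : ℕ) → TDom 4 ((lam13 (Ps k v m)).n + 1) → Wn k v m → (lam13 (Ps k v m)).Φ)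
  (hemb : ∀ k v m X, ∀ u ∈ ball (0 : Wn k v m) α₂, emb k v m X u ∈ (lam13 (Ps k v m)).sp2 X)
  (hH : ∀ k v m (X Z : TDom 4 ((lam13 (Ps k v m)).n + 1)), Z.1 ⊆ X.1 →
    DifferentiableOn ℂ (fun u => (lam13 (Ps k v m)).H Z (emb k v m X u)) (ball 0 α₂))
  (D : (k : ℕ) → (v : Fin (k + 1) → ℝ) → Data190 4 M (NOfLayers fun m => lam13 (Ps k v m)) (Wn k v) q)
  (V : (k : ℕ) → (Fin (k + 1) → ℝ) → LDom 4 → Type) (instV : ∀ k v Y, NormedAddCommGroup (V k v Y))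
  (instVs : ∀ k v Y, NormedSpace ℂ (V k v Y))
  (Fw : (k : ℕ) → (v : Fin (k + 1) → ℝ) → (Y : LDom 4) → V k v Y → ℂ)
  (hFd : ∀ k v Y, ∃ ρ > 0, DifferentiableOn ℂ (Fw k v Y) (ball 0 ρ))
  (r : (k : ℕ) → (v : Fin (k + 1) → ℝ) → (m : ℕ) → (Y : LDom 4) → Wn k v m →L[ℂ] V k v Y)
  (hfac : ∀ k v (Y : LDom 4), ∀ᶠ m in atTop, ∀ u ∈ ball (0 : Wn k v m) α₂,
    (lam13 (Ps k v m)).Ek1 (tproj ((lam13 (Ps k v m)).n + 1) Y) (emb k v m (tproj ((lam13 (Ps k v m)).n + 1) Y) u) =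
      Fw k v Y (r k v m Y u))
  (t : (k : ℕ) → (v : Fin (k + 1) → ℝ) → (Y : LDom 4) → Pt 4 → V k v Y)
  (hconv : ∀ k v (Y : LDom 4) (x : Pt 4),
    Tendsto (fun m => r k v m Y ((D k v).hn m (tproj ((lam13 (Ps k v m)).n + 1) Y) (proj (((lam13 (Ps k v m)).n + 1) * M) x)))
      atTop (𝓝 (t k v Y x)))
  (ha : ∀ k v (Y : LDom 4) (z : Pt 4), A1 k v Y z = (mixedDeriv (Fw k v Y) (t k v Y 0) (t k v Y z)).re)

include hle hm hsp h213 hleaf hR hC hs hn hc instW instWs hemb hH hFd hfac hconv ha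

/-- **CRUX K2′'s REGISTERED STUB `D4AtSlopeOfD1Record12` AT THE TUPLE θ FROM THE RECORD's RUN-INDEXED [B13] LAYERS, (C-pt) REPLACED BY (C-leaf) IN THE (1.7) LETTERS**:
p470063's `d4AtSlopeOfD1Record12_at_of_runLayers` (re-derived here over an4's object along run sequences) with its last hypothesis — continuity in the history of the SUMMED site kernel — replaced by continuity in the history
of the (1.7) read-outs `v ↦ Re ∂²(Fw k v Y)(t k v Y 0, t k v Y z)` per scale, domain and site (`leafwise_of_readout` + `cpt_of_leafwise`: the summation over the domains
is paid by the layers' own history-free majorant).  A REDUCTION of the stub's body at θ to displayed inputs on the record's residual objects — NOT a proof of the stub;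
instance 0∕1. [cite: Balaban1988RG2Cluster, Lemma 3 (2.38) p.20 and p.21; Balaban1987RG1, (1.7) p.261, (1.20)-(1.22) p.264, (5.1) p.292; Balaban1985Variational, (190) p.308] -/
theorem d4AtSlopeOfD1Record12_at_of_runLayers_leafwise (hγ₀ : 0 < γ₀) (h22 : c.R22gen ((c.L : ℝ) / 2)) (hq : q.Valid c.δ₀)
    {Lc : ℕ} {Nc : ℝ} (hsmall : c.ε₁ * remCoeffL 4 M c α₂ q.B₃ ≤ B12Normalization.stepBal Nc Lc)
    (hcont : ∀ k (Y : LDom 4) (z : Pt 4),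
      ContinuousOn (fun v : Fin (k + 1) → ℝ => (mixedDeriv (Fw k v Y) (t k v Y 0) (t k v Y z)).re) (Box γ₀ k)) :
    letI := θ.instVβ₁; letI := θ.instVβ₂; letI := θ.instιβ
    ∃ γ₁ : ℝ, 0 < γ₁ ∧ γ₁ ≤ θ.γ ∧
      AtSlopeCont
        (oneLoopSplit_betaOfMerged (betaMerged F (mergedTermFamilyMatT F N (TcOfRecord F N) (chiFixed7 F N θ.ν) θ.εbg) θ.ρ8 θ.bV)
          (beta0OfMerged (betaMerged F (mergedTermFamilyMatT F N (TcOfRecord F N) (chiFixed7 F N θ.ν) θ.εbg) θ.ρ8 θ.bV) θ.v₀) θ.γ)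
        γ₁ (B12Normalization.stepBal Nc Lc) :=
  ⟨γ₀, hγ₀, hle,
    atSlopeCont_of_chainTFac190H_leafwise
      (chainTFac190H_ofB13Layers F N (θ.toStage11 F N p) hle A1 hm (fun k v m => lam13 (Ps k v m)) hn hc
        (fun k v m => hsp (Ps k v m)) (fun k v m => h213 (Ps k v m)) (fun k v m => hleaf (Ps k v m))
        (fun k v m => hR (Ps k v m)) hC hs Wn instW instWs emb hemb hH D V instV instVs Fw hFd r hfac t hconv ha)
      hC h22 hq hs hsmall (leafwise_of_readout ha hcont)⟩

end RunLayers

end Summit.QuantumFields.YangMills.Theorems.BalabanUVNodesN26CPtLeafwise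

end
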